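import Summits.QuantumAdvantage.QuantumAdvantage.Theses.LinnikCubicClassGroups
import Summits.QuantumAdvantage.QuantumAdvantage.Theorems.LinnikCubicClassGroupsPureCubicClassGroupFBQPStubCubicFieldFacts
import Literature.Computability.Cryptography.CubicClassStageSpecs

/-!
# Crux `LinnikCubicClassGroups.PureCubicClassGroupFBQP` (stmt-QuantumAdvantage-11544) — the format lemmas of the class-group stage

Line `arakelov-giant-step-cycle`, stub `stub_classStageAssembly` (S5b-ASM), first helper file: the three ELEMENTARY conjuncts
of `CubicClassStage.ClassStageGoal` (`Literature/Computability/Cryptography/CubicClassStageSpecs.lean`) —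

* `classStage_incl1 : ClassStageIncl₁` — the regulator relation ("on `⟨⟨x, ⟨f,a,b⟩⟩, 1^k⟩` with `m = f³ab²` output `⟨bin r, ·⟩`
  with `|r − 2^k R_K| ≤ 1` for every admissible `K`") refines the advice relation of the advice chain (well-formed query ⇒ some
  `⟨bin r, t⟩` whose `r` is good for EVERY reading of the query): an admissible field exists (`stub_cubicFieldFacts`), and the
  answer determines `r` (`boolUnpair_boolPair`, `Computability.decode_encodeNat`);
* `classStage_incl2 : ClassStageIncl₂` — the chain's goal relation refines the subgroup-order relation;
* `classStage_convex : ClassStageConvex` — the good advice values form an interval.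

No number theory beyond the existence of `ℚ(∛m)`.
-/

-- the problem namespace repeats the summit name (`QuantumAdvantage.QuantumAdvantage`)
set_option linter.dupNamespace false

namespace Summit.QuantumAdvantage.QuantumAdvantage.Theorems.LinnikCubicClassGroups

open Computability (encodeNat decodeNat)
open Literature.Computability.Complexity (boolPair boolUnpair boolUnpair_boolPair encodingListNatBool)
open Literature.Computability.Cryptography.CubicClassStage (ClassStageIncl₁ ClassStageIncl₂ ClassStageConvex)
open scoped NumberField

/-- **Format lemma 1 (`ClassStageIncl₁`)**: the regulator relation refines the advice relation. -/
theorem classStage_incl1 : ClassStageIncl₁ := by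
  intro q y hy
  simp only [Set.mem_setOf_eq] at hy ⊢
  rintro ⟨x, f, a, b, k, hq, hdec, hsq, hnc⟩
  -- an admissible field
  obtain ⟨⟨K, iF, iN, hdeg, α, hα⟩, -⟩ := stub_cubicFieldFacts (decodeNat x) hnc
  obtain ⟨r, t, hy', hr⟩ := hy x f a b k hq hdec hsq K hdeg hnc ⟨α, hα⟩
  refine ⟨r, t, hy', ?_⟩
  intro x' f' a' b' k' hq' hdec' hsq' K' _ _ hdeg' hnc' hα'
  obtain ⟨r', t', hy'', hr'⟩ := hy x' f' a' b' k' hq' hdec' hsq' K' hdeg' hnc' hα'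
  rw [hy'] at hy''
  -- the answer determines `r`: `boolPair` and `encodeNat` are injective
  have hrr : r = r' := by
    have h1 := congrArg boolUnpair hy''
    rw [boolUnpair_boolPair, boolUnpair_boolPair] at h1
    have h2 := congrArg decodeNat (Prod.mk.inj h1).1
    rwa [Computability.decode_encodeNat, Computability.decode_encodeNat] at h2
  rw [hrr]
  exact hr'

/-- **Format lemma 2 (`ClassStageIncl₂`)**: the chain's goal relation refines the subgroup-order relation. -/
theorem classStage_incl2 : ClassStageIncl₂ := by
  intro w z hz
  simp only [Set.mem_setOf_eq] at hz ⊢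
  intro x f a b ps hw hdec hsq K _ _ hdeg hnc hα hps
  obtain ⟨o, t, hz', ho⟩ := hz ⟨x, f, a, b, ps, hw, hdec, hsq, hnc, hps⟩
  exact ⟨t, by rw [hz', ho x f a b ps hw hdec hsq K hdeg hnc hα hps]⟩

/-- **Format lemma 3 (`ClassStageConvex`)**: the good advice values form an interval. -/
theorem classStage_convex : ClassStageConvex := by
  intro q r₁ r₂ r h₁ h₂ h1r hr2 x f a b k hq hdec hsq K _ _ hdeg hnc hα
  have e₁ := h₁ x f a b k hq hdec hsq K hdeg hnc hα
  have e₂ := h₂ x f a b k hq hdec hsq K hdeg hnc hα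
  rw [abs_le] at e₁ e₂ ⊢
  have c1 : (r₁ : ℝ) ≤ r := by exact_mod_cast h1r
  have c2 : (r : ℝ) ≤ r₂ := by exact_mod_cast hr2
  constructor <;> linarith [e₁.1, e₂.2]

end Summit.QuantumAdvantage.QuantumAdvantage.Theorems.LinnikCubicClassGroups
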